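import Mathlib.Combinatorics.SimpleGraph.Walk.Counting
import Mathlib.Combinatorics.SimpleGraph.Paths
import Mathlib.Combinatorics.SimpleGraph.DeleteEdges
import Literature.Probability.RandomPlanarGeometry.SelfAvoidingWalk
import Summits.CriticalPhenomena.SAWScalingLimit.Theses.SAWTotalPositivity
import Summits.CriticalPhenomena.SAWScalingLimit.Theorems.BoundaryTP2Negative_Enumeration
import Summits.CriticalPhenomena.SAWScalingLimit.Theorems.SAWTotalPositivityBoundaryHarnackRealisation
import HarnessLib
import Summits.CriticalPhenomena.SAWScalingLimit.Theorems.SAWTotalPositivityBoundaryTP2Defs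

/-!
# Crux `BoundaryTP2` (stmt-CriticalPhenomena-7115), line `Sketch`: the path-kernel API and the transfer lemma

Everything proved. Contents (namespace `…Theorems.BoundaryTP2`):

* finiteness: a graph with finitely many non-isolated vertices is locally finite and has finitely many
  self-avoiding paths between any two vertices (`finite_path`), so `pathKernel H x a b < ∞`;
* the dictionary with the crux's objects: `domainSAWEquivPath : SAW.DomainSAW Ω δ a b ≃ (Ω_δ).Path a b`,
  `weight_univ_eq_pathKernel : SAW.weight Ω δ a b univ = pathKernel (discreteDomainGraph Ω δ) x_c a b`,
  `discreteDomainGraph_le_zdGraph`, `support_discreteDomainGraph_finite`;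
* **the transfer** `boundaryTP2_of_graphTP2At : GraphTP2At x_c → BoundaryTP2` (the composition step of
  the line's skeleton) and `graphTP2At_of_interlacedTP2At : InterlacedTP2At x → GraphTP2At x`;
* **the converse on induced subgraphs** `tp2_induced_of_boundaryTP2`: `BoundaryTP2` gives the TP₂ inequality
  at `x_c` for every interlaced, disjointly realisable quadruple of `ℤ²[V]`, `V` finite and lattice-connected
  (realisation `…BoundaryHarnack.Realisation.exists_domain_of_connected`) — so the reduction to the core loses
  at most the non-induced subgraphs.
-/

noncomputable section

namespace Summit.CriticalPhenomena.SAWScalingLimit.Theorems.BoundaryTP2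

open Literature.Probability.LatticeModels Literature.Probability.RandomPlanarGeometry
open scoped ENNReal

variable {V : Type*}


/-! ## Finiteness -/

section Finiteness

variable {H : SimpleGraph V}

/-- Neighbours of a vertex are non-isolated vertices. [folklore] -/
theorem neighborSet_subset_support (H : SimpleGraph V) (v : V) : H.neighborSet v ⊆ H.support :=
  fun w hw => (SimpleGraph.mem_support _).2 ⟨v, (H.mem_neighborSet v w).1 hw |>.symm⟩

/-- A graph with finitely many non-isolated vertices is locally finite (noncomputably). [folklore] -/
abbrev locallyFiniteOfSupportFinite (hfin : H.support.Finite) : H.LocallyFinite :=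
  fun v => (hfin.subset (neighborSet_subset_support H v)).fintype

/-- Every vertex of a walk is its starting point or a non-isolated vertex. [folklore] -/
theorem mem_support_walk {a b : V} (p : H.Walk a b) :
    ∀ v ∈ p.support, v = a ∨ v ∈ H.support := by
  induction p with
  | nil => intro v hv; simp only [SimpleGraph.Walk.support_nil, List.mem_singleton] at hv; exact Or.inl hv
  | @cons u w _ h q ih =>
    intro v hv
    simp only [SimpleGraph.Walk.support_cons, List.mem_cons] at hv
    rcases hv with rfl | hv
    · exact Or.inl rfl
    · rcases ih v hv with rfl | hv'
      · exact Or.inr ((SimpleGraph.mem_support _).2 ⟨u, h.symm⟩)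
      · exact Or.inr hv'

/-- The length of a self-avoiding path is at most the number of non-isolated vertices. [folklore] -/
theorem length_lt_of_isPath (hfin : H.support.Finite) {a b : V} {p : H.Walk a b} (hp : p.IsPath) :
    p.length < hfin.toFinset.card + 1 := by
  classical
  have hsub : p.support.toFinset ⊆ insert a hfin.toFinset := by
    intro v hv
    rw [List.mem_toFinset] at hv
    rcases mem_support_walk p v hv with rfl | hv'
    · exact Finset.mem_insert_self _ _
    · exact Finset.mem_insert_of_mem (hfin.mem_toFinset.2 hv')
  have hcard : p.support.toFinset.card = p.length + 1 := by
    rw [List.toFinset_card_of_nodup hp.support_nodup, SimpleGraph.Walk.length_support]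
  have := (Finset.card_le_card hsub).trans (Finset.card_insert_le _ _)
  omega

/-- A graph with finitely many non-isolated vertices has finitely many self-avoiding paths between any
two vertices. [folklore] -/
theorem finite_path (hfin : H.support.Finite) (a b : V) : Finite (H.Path a b) := by
  classical
  haveI : H.LocallyFinite := locallyFiniteOfSupportFinite hfin
  let N := hfin.toFinset.card + 1
  let f : H.Path a b → {p : H.Walk a b // p.IsPath ∧ p.length < N} :=
    fun γ => ⟨γ.1, γ.2, length_lt_of_isPath hfin γ.2⟩
  have hf : Function.Injective f := by
    intro γ γ' h
    have : γ.1 = γ'.1 := congrArg (fun q : {p : H.Walk a b // p.IsPath ∧ p.length < N} => q.1) h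
    exact Subtype.ext this
  exact Finite.of_injective f hf

/-- For finitely many non-isolated vertices the path kernel is a finite sum. [folklore] -/
theorem pathKernel_eq_sum (x : ℝ) (a b : V) [Fintype (H.Path a b)] :
    pathKernel H x a b = ∑ γ : H.Path a b, ENNReal.ofReal (x ^ γ.1.length) := by
  rw [pathKernel, tsum_fintype]

/-- The path kernel of a graph with finitely many non-isolated vertices is finite. [folklore] -/
theorem pathKernel_lt_top (hfin : H.support.Finite) (x : ℝ) (a b : V) : pathKernel H x a b < ∞ := by
  haveI : Finite (H.Path a b) := finite_path hfin a b
  haveI : Fintype (H.Path a b) := Fintype.ofFinite _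
  rw [pathKernel_eq_sum]
  exact ENNReal.sum_lt_top.2 fun _ _ => ENNReal.ofReal_lt_top

/-- The path kernel of a graph with finitely many non-isolated vertices is not `∞`. [folklore] -/
theorem pathKernel_ne_top (hfin : H.support.Finite) (x : ℝ) (a b : V) : pathKernel H x a b ≠ ∞ :=
  (pathKernel_lt_top hfin x a b).ne

/-- The restricted kernel is at most the full kernel. [folklore] -/
theorem pathKernelOn_le (x : ℝ) (a b : V) (S : Set (H.Path a b)) :
    pathKernelOn H x a b S ≤ pathKernel H x a b :=
  ENNReal.tsum_le_tsum fun γ => Set.indicator_le_self _ _ γ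

/-- The kernel restricted to all paths is the kernel. [folklore] -/
@[simp] theorem pathKernelOn_univ (x : ℝ) (a b : V) :
    pathKernelOn H x a b Set.univ = pathKernel H x a b := by
  simp [pathKernelOn, pathKernel]

/-- Splitting the kernel along a set of paths and its complement. [folklore] -/
theorem pathKernelOn_add_compl (x : ℝ) (a b : V) (S : Set (H.Path a b)) :
    pathKernelOn H x a b S + pathKernelOn H x a b Sᶜ = pathKernel H x a b := by
  rw [pathKernelOn, pathKernelOn, ← ENNReal.tsum_add]
  refine tsum_congr fun γ => ?_
  by_cases h : γ ∈ S
  · simp [Set.indicator_of_mem h, Set.indicator_of_notMem (Set.notMem_compl_iff.2 h)]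
  · simp [Set.indicator_of_notMem h, Set.indicator_of_mem (Set.mem_compl h)]

/-- A single path bounds the kernel from below. [folklore] -/
theorem single_le_pathKernel (x : ℝ) {a b : V} (γ : H.Path a b) :
    ENNReal.ofReal (x ^ γ.1.length) ≤ pathKernel H x a b :=
  ENNReal.le_tsum (f := fun γ : H.Path a b => ENNReal.ofReal (x ^ γ.1.length)) γ

end Finiteness

/-! ## Dictionary with the crux's objects -/

section Dictionary

variable (Ω : Set ℂ) (δ : ℝ) (a b : Site 2)

/-- A SAW of the discrete domain is exactly a self-avoiding path of the graph `Ω_δ`. [folklore] -/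
def domainSAWEquivPath : SAW.DomainSAW Ω δ a b ≃ (discreteDomainGraph Ω δ).Path a b where
  toFun γ := ⟨γ.walk, γ.isPath⟩
  invFun p := ⟨p.1, p.2⟩
  left_inv γ := by cases γ; rfl
  right_inv p := by cases p; rfl

/-- The crux's partition function is the critical path kernel of `Ω_δ`. [folklore] -/
theorem weight_univ_eq_pathKernel :
    SAW.weight Ω δ a b Set.univ = pathKernel (discreteDomainGraph Ω δ) SAW.criticalFugacity a b := by
  rw [Negative.weight_univ, pathKernel]
  exact Equiv.tsum_eq (domainSAWEquivPath Ω δ a b)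
    (fun γ : (discreteDomainGraph Ω δ).Path a b => ENNReal.ofReal (SAW.criticalFugacity ^ γ.1.length))

/-- `Ω_δ` is a subgraph of `ℤ²`. [folklore] -/
theorem discreteDomainGraph_le_zdGraph : discreteDomainGraph Ω δ ≤ zdGraph 2 :=
  (discreteDomainGraph_le_meshGraph Ω δ).trans (meshGraph_le_zdGraph Ω δ)

/-- For bounded `Ω` and `δ > 0` the graph `Ω_δ` has finitely many non-isolated vertices. [folklore] -/
theorem support_discreteDomainGraph_finite {Ω : Set ℂ} {δ : ℝ} (hΩ : Bornology.IsBounded Ω)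
    (hδ : 0 < δ) : (discreteDomainGraph Ω δ).support.Finite := by
  refine (meshVertices_finite hΩ hδ).subset ?_
  intro v hv
  obtain ⟨w, hw⟩ := (SimpleGraph.mem_support _).1 hv
  exact meshDomain_subset_meshVertices Ω δ (discreteDomainGraph_adj_iff.1 hw).2.1

/-- Hypothesis (i) of the crux is `Interlaced (Ω_δ)`. [folklore] -/
theorem interlaced_of_domainSAW {Ω : Set ℂ} {δ : ℝ} {p₁ p₂ p₃ p₄ : Site 2}
    (h : ∀ (P : SAW.DomainSAW Ω δ p₁ p₃) (Q : SAW.DomainSAW Ω δ p₂ p₄),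
      ∃ v, v ∈ P.walk.support ∧ v ∈ Q.walk.support) :
    Interlaced (discreteDomainGraph Ω δ) p₁ p₂ p₃ p₄ :=
  fun P Q => h ⟨P.1, P.2⟩ ⟨Q.1, Q.2⟩

/-- Hypotheses (ii)/(iii) of the crux are `DisjointPaths (Ω_δ)`. [folklore] -/
theorem disjointPaths_of_domainSAW {Ω : Set ℂ} {δ : ℝ} {p q r s : Site 2}
    (h : ∃ (P : SAW.DomainSAW Ω δ p q) (Q : SAW.DomainSAW Ω δ r s),
      List.Disjoint P.walk.support Q.walk.support) :
    DisjointPaths (discreteDomainGraph Ω δ) p q r s := by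
  obtain ⟨P, Q, hPQ⟩ := h
  exact ⟨⟨P.walk, P.isPath⟩, ⟨Q.walk, Q.isPath⟩, hPQ⟩

end Dictionary

/-! ## The transfer -/

/-- Hypotheses (ii) and (iii) force the four marked vertices to be pairwise distinct. [folklore] -/
theorem pairwise_ne_of_disjointPaths {H : SimpleGraph V} {p₁ p₂ p₃ p₄ : V}
    (h₁ : DisjointPaths H p₁ p₂ p₃ p₄) (h₂ : DisjointPaths H p₁ p₄ p₂ p₃) :
    p₁ ≠ p₂ ∧ p₁ ≠ p₃ ∧ p₁ ≠ p₄ ∧ p₂ ≠ p₃ ∧ p₂ ≠ p₄ ∧ p₃ ≠ p₄ := by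
  obtain ⟨P, Q, hPQ⟩ := h₁
  obtain ⟨P', Q', hPQ'⟩ := h₂
  have h13 : p₁ ≠ p₃ := fun h => hPQ P.1.start_mem_support (h ▸ Q.1.start_mem_support)
  have h14 : p₁ ≠ p₄ := fun h => hPQ P.1.start_mem_support (h ▸ Q.1.end_mem_support)
  have h23 : p₂ ≠ p₃ := fun h => hPQ P.1.end_mem_support (h ▸ Q.1.start_mem_support)
  have h24 : p₂ ≠ p₄ := fun h => hPQ P.1.end_mem_support (h ▸ Q.1.end_mem_support)
  have h12 : p₁ ≠ p₂ := fun h => hPQ' P'.1.start_mem_support (h ▸ Q'.1.start_mem_support)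
  have h34 : p₃ ≠ p₄ := fun h => hPQ' P'.1.end_mem_support (h ▸ Q'.1.end_mem_support)
  exact ⟨h12, h13, h14, h23, h24, h34⟩

/-- The interlacing-only strengthening implies the combinatorial core. [folklore] -/
theorem graphTP2At_of_interlacedTP2At {x : ℝ} (h : InterlacedTP2At x) : GraphTP2At x := by
  intro H hH hfin p₁ p₂ p₃ p₄ hI hD₁ hD₂
  obtain ⟨h12, h13, h14, h23, h24, h34⟩ := pairwise_ne_of_disjointPaths hD₁ hD₂
  exact h H hH hfin p₁ p₂ p₃ p₄ h12 h13 h14 h23 h24 h34 hI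

/-- **Transfer.** The combinatorial core at `x_c` implies the crux `BoundaryTP2` as typed: instantiate the
core at `H = Ω_δ = discreteDomainGraph Ω δ ≤ ℤ²`, which has finitely many non-isolated vertices for bounded
`Ω` and `δ > 0`, and translate partition functions and hypotheses through `domainSAWEquivPath`. (The
hypothesis `SimplyConnectedSpace Ω` of the crux is not used — refuter rreview-6d2977b1.) [folklore] -/
theorem boundaryTP2_of_graphTP2At (h : GraphTP2At SAW.criticalFugacity) :
    Summit.CriticalPhenomena.SAWScalingLimit.Theses.SAWTotalPositivity.BoundaryTP2 := by
  intro Ω δ p₁ p₂ p₃ p₄ hΩ _ hδ hI hD₁ hD₂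
  have key := h (discreteDomainGraph Ω δ) (discreteDomainGraph_le_zdGraph Ω δ)
    (support_discreteDomainGraph_finite hΩ hδ) p₁ p₂ p₃ p₄ (interlaced_of_domainSAW hI)
    (disjointPaths_of_domainSAW hD₁) (disjointPaths_of_domainSAW hD₂)
  simpa only [weight_univ_eq_pathKernel] using key


/-! ## The converse on induced, lattice-connected subgraphs -/

section Converse

/-- A walk between distinct vertices starts with an edge. [folklore] -/
theorem exists_adj_of_walk_ne {H : SimpleGraph V} {a b : V} (p : H.Walk a b) (hab : a ≠ b) :
    ∃ u, H.Adj a u := by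
  cases p with
  | nil => exact absurd rfl hab
  | cons h _ => exact ⟨_, h⟩

/-- A finite nonempty set of sites lies in a nonempty box of sites. [folklore] -/
theorem exists_boxSites_of_finite {S : Set (Site 2)} (hS : S.Finite) (hne : S.Nonempty) :
    ∃ a b : Site 2, (∀ i, a i ≤ b i) ∧ S ⊆ boxSites a b := by
  classical
  obtain ⟨v₀, hv₀⟩ := hne
  have hne' : hS.toFinset.Nonempty := ⟨v₀, hS.mem_toFinset.2 hv₀⟩
  refine ⟨fun i => hS.toFinset.inf' hne' (fun v => v i), fun i => hS.toFinset.sup' hne' (fun v => v i),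
    fun i => ?_, fun v hv i => ⟨?_, ?_⟩⟩
  · exact (Finset.inf'_le (fun v => v i) (hS.mem_toFinset.2 hv₀)).trans
      (Finset.le_sup' (fun v => v i) (hS.mem_toFinset.2 hv₀))
  · exact Finset.inf'_le (fun v => v i) (hS.mem_toFinset.2 hv)
  · exact Finset.le_sup' (fun v => v i) (hS.mem_toFinset.2 hv)

/-- **Converse of the transfer on induced subgraphs.** `BoundaryTP2` implies the TP₂ inequality at `x_c`
for every interlaced, disjointly realisable quadruple of the graph `ℤ²[V]` induced by a finite,
lattice-connected set of sites `V` (given here through its adjacency relation, to stay on the vertex type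
`Site 2`): `ℤ²[V]` is the discrete domain, at mesh `1`, of a bounded simply connected planar set
(`Realisation.exists_domain_of_connected`). [folklore] -/
theorem tp2_induced_of_boundaryTP2
    (hTP : Summit.CriticalPhenomena.SAWScalingLimit.Theses.SAWTotalPositivity.BoundaryTP2)
    {S : Set (Site 2)} (hS : S.Finite)
    (hconn : ∀ x ∈ S, ∀ y ∈ S, Relation.ReflTransGen (SiteStep S) x y)
    {H : SimpleGraph (Site 2)} (hH : ∀ x y, H.Adj x y ↔ (zdGraph 2).Adj x y ∧ x ∈ S ∧ y ∈ S)
    {p₁ p₂ p₃ p₄ : Site 2} (hI : Interlaced H p₁ p₂ p₃ p₄) (hD₁ : DisjointPaths H p₁ p₂ p₃ p₄)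
    (hD₂ : DisjointPaths H p₁ p₄ p₂ p₃) :
    pathKernel H SAW.criticalFugacity p₁ p₃ * pathKernel H SAW.criticalFugacity p₂ p₄ ≤
      pathKernel H SAW.criticalFugacity p₁ p₂ * pathKernel H SAW.criticalFugacity p₃ p₄ := by
  -- `S` is nonempty: `p₁` carries an edge of `H`
  obtain ⟨h12, -, -, -, -, -⟩ := pairwise_ne_of_disjointPaths hD₁ hD₂
  have hne : S.Nonempty := by
    obtain ⟨P, -, -⟩ := hD₁
    obtain ⟨u, hu⟩ := exists_adj_of_walk_ne P.1 h12
    exact ⟨p₁, ((hH p₁ u).1 hu).2.1⟩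
  obtain ⟨a, b, hab, hSbox⟩ := exists_boxSites_of_finite hS hne
  obtain ⟨Ω, hΩb, hΩsc, hadj⟩ := BoundaryHarnack.Realisation.exists_domain_of_connected hab hSbox hconn
  have hHΩ : H = discreteDomainGraph Ω 1 := by
    ext x y
    rw [hH, hadj]
  subst hHΩ
  have key := hTP Ω 1 p₁ p₂ p₃ p₄ hΩb hΩsc one_pos
    (fun P Q => hI ⟨P.walk, P.isPath⟩ ⟨Q.walk, Q.isPath⟩)
    (by obtain ⟨P, Q, hPQ⟩ := hD₁; exact ⟨⟨P.1, P.2⟩, ⟨Q.1, Q.2⟩, hPQ⟩)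
    (by obtain ⟨P, Q, hPQ⟩ := hD₂; exact ⟨⟨P.1, P.2⟩, ⟨Q.1, Q.2⟩, hPQ⟩)
  simpa only [weight_univ_eq_pathKernel] using key

end Converse

end Summit.CriticalPhenomena.SAWScalingLimit.Theorems.BoundaryTP2
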